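import Summits.AnomalousDissipation.AnomalousDissipation.Theorems.SolenoidalFractalHomogenisationLagrangianStepCellLawVQSBlock
import HarnessLib

/-!
# K1L `LagrangianRenormalisationStep(Design)` (K1L_D, stmt-AnomalousDissipation-27980; aside 24912), stub `stub_cellLawV0_IS`
# — W2 (iv): `QSPinch` — the LOEWNER PINCH of the quasi-static cell response `excQS` (`LoewnerWindowSketch` S2, PROVED)
# (helper; `--supports stmt-AnomalousDissipation-27980`; word-independent: every lattice shear word `W`, every pre-stretch `M ≥ 0`)

Summits-side helper file of route `SolenoidalFractalHomogenisation` (planner ad-ideate-p5's STUB-PLAN for `stub_cellLawV`,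
`Cruxes/LagrangianRenormalisationStep/STUB-IDEAS-stub_cellLawV-p5.md` §1 (W) W1 / `LoewnerWindowSketch.lean` S2 «QSPinch»; tenure planner ad-ideate-p1 WORKER FIT v2
item W2 `…LagrangianStepCellLawVQSPinch.lean`; director-frontier K-AD-L3; last of four files, on top of `…CellLawVSemigroupPerp` (p642614), `…CellLawVQSResp`,
`…CellLawVQSBlock`).
* VERBATIM copies (same short names, same bodies) of the Cruxes sketch's `transversePairs`, `excQS`, `slotGainC`, `gainForm` (the sketch
  `Cruxes/LagrangianRenormalisationStep/LoewnerWindowSketch.lean` is not importable on the farm, STUB-IDEAS §6), in the registered namespace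
  `…Theorems.SolenoidalFractalHomogenisation.LagrangianStep` next to `slotWeight` / `mhat` / `excShape` (p610007); bookkeeping names `slotQ`, `slotCoef`.
* `bsymb_excQS` / `symb_excQS` — the transverse (bi)linear symbol of `excQS` slot by slot: `β(k; p, q) = Σ_s coef_s (e_s·k)² · pᵀ Q_s q`;
  `gainForm_div` — `gainForm(x)/x = Σ_s coef_s (e_s·q)² f_{T_s}(x) (|p|² − (p·m̂_s)²)` (`ϑ(T x) = x f_T(x)`).
* `oddSmall_excQS` — `excQS` PRESERVES SYMMETRIC TRANSVERSE BLOCKS (`OddSmall S 0 → OddSmall (excQS W M S) 0`); `symb_excQS_le` / `le_symb_excQS` —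
  THE PINCH `gainForm(b)/b ≤ symb (excQS W M S) q p ≤ gainForm(a)/a` for `OddSmall S 0`, `NearIso S a b`, `0 < a ≤ b`, `M ≥ 0`, ALL `q, p`;
  `qsPinch W M` — the body of the sketch's `QSPinch W M` VERBATIM, proved.  With this, the window half (W) of `stub_cellLawV0_IS` for any map built from
  `excQS` reduces to inequalities between the explicit quartic forms `gainForm W M x` (sketch S3/S3′/S6: `gainSup(lo) ≤ N·lo·hi ≤ gainInf(hi)`).
No named facts, no sorry.  Infrastructure for route-1's rung leaf F-D1.A0 (frontier FORMAL rung); NOT a proof of the stub, of the crux, of Onsager's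
conjecture or of anomalous dissipation.  Prover seat `ad-k1l-cellLawV-w1` g0, 2026-08-28.
-/

set_option linter.dupNamespace false

noncomputable section

namespace Summit.AnomalousDissipation.AnomalousDissipation.Theorems.SolenoidalFractalHomogenisation.LagrangianStep

open Literature.Analysis Literature.Analysis.FluidPDE Literature.Analysis.FunctionSpaces
open Literature.Analysis.ODE.PeriodicAveraging
open MeasureTheory Set

/-! ## §3 Tensor-level vocabulary (VERBATIM copies of `LoewnerWindowSketch.lean`) -/

section Tensor

/-- Unit transverse pairs `(q, p)`: `|q| = |p| = 1`, `p ⊥ q` (the arguments on which `Torus.NearIso` constrains `Torus.symb`).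
(VERBATIM copy of `Cruxes/LagrangianRenormalisationStep/LoewnerWindowSketch.lean` `transversePairs`.) -/
def transversePairs : Set ((Fin 3 → ℝ) × (Fin 3 → ℝ)) :=
  {qp | ∑ a, qp.1 a ^ 2 = 1 ∧ ∑ i, qp.2 i ^ 2 = 1 ∧ ∑ i, qp.2 i * qp.1 i = 0}

/-- The QUASI-STATIC EXCESS tensor of the word `W` pre-stretched by `M` at background shape `S` (per unit `1/ν²`): `excShape` with the
frozen factor `ϑ(T_s)·Q_s(S)` replaced by the rate-dependent response `f_{T_s}(B_s(S) + m̂m̂ᵀ)·P_s` (`T_s = 4π²|m_s|²Mτ_s`; at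
`S = I` the two coincide).  (VERBATIM copy of `LoewnerWindowSketch.lean` `excQS`.) -/
def excQS {k : ℕ} (W : LatticeShear.LatticeWord k) (M : ℝ) (S : Torus.Visc4 (Fin 3)) : Torus.Visc4 (Fin 3) := fun i a j b =>
  ∑ s, (let P := W.phase s
    let mn : ℝ := ‖Torus.latticeVec P.m‖
    let Sig : Matrix (Fin 3) (Fin 3) ℝ := fun i' j' => ∑ a', ∑ b', S i' a' j' b' * mhat P a' * mhat P b'
    let Pm : Matrix (Fin 3) (Fin 3) ℝ := fun i' j' => (if i' = j' then 1 else 0) - mhat P i' * mhat P j'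
    let Q : Matrix (Fin 3) (Fin 3) ℝ := qsResp W.ramp (4 * Real.pi ^ 2 * mn ^ 2 * M * P.τ) (Pm * Sig * Pm + Matrix.vecMulVec (mhat P) (mhat P)) * Pm
    P.τ / (2 * (2 * Real.pi * mn) ^ 4) / W.period * (P.e a * P.e b) * Q i j)

/-- Slot gain of a phase in coordinates (`= LatticeShear.slotGain P q p` for `p ⊥ q`):
`τ/(2(2π|m|)⁴) · (e·q)² · (|p|² − (p·m̂)²)`.  (VERBATIM copy of `LoewnerWindowSketch.lean` `slotGainC`.) -/
def slotGainC (P : LatticeShear.LatticePhase) (q p : Fin 3 → ℝ) : ℝ :=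
  P.τ / (2 * (2 * Real.pi * ‖Torus.latticeVec P.m‖) ^ 4) * (∑ a, P.e a * q a) ^ 2 * (∑ i, p i ^ 2 - (∑ i, p i * mhat P i) ^ 2)

/-- The REALISED GAIN FORM at shape level `x > 0`: `gainForm W M x q p = Σ_s ϑ(ρ, T_s·x) · slotGain_s(q,p) / period` — the transverse
symbol of `x · excQS W M (x·I)`; for the frozen model, `symb (excShape W M I) q p = gainForm W M 1 q p` on transverse pairs.
(VERBATIM copy of `LoewnerWindowSketch.lean` `gainForm`.) -/
def gainForm {k : ℕ} (W : LatticeShear.LatticeWord k) (M x : ℝ) (q p : Fin 3 → ℝ) : ℝ :=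
  ∑ s, slotWeight W.ramp (4 * Real.pi ^ 2 * ‖Torus.latticeVec (W.phase s).m‖ ^ 2 * M * (W.phase s).τ * x) * slotGainC (W.phase s) q p / W.period

end Tensor

/-! ## §5 Assembly: the transverse bilinear symbol of `excQS` slot by slot, and the pinch `QSPinch` -/

section Assembly

variable {k : ℕ}

/-- `m̂` is a unit vector: `Σ_a m̂_a² = 1`. [folklore] -/
theorem sum_mhat_sq (P : LatticeShear.LatticePhase) : ∑ a, mhat P a ^ 2 = 1 := by
  have hne : Torus.latticeVec P.m ≠ 0 := by
    intro h
    apply P.m_ne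
    funext i
    have hi := congrArg (fun v : EuclideanSpace ℝ (Fin 3) => v i) h
    simp only [Torus.latticeVec_apply, PiLp.zero_apply] at hi
    exact_mod_cast hi
  have hpos : 0 < ‖Torus.latticeVec P.m‖ := norm_pos_iff.2 hne
  simp only [mhat, div_pow, ← Finset.sum_div]
  rw [← EuclideanSpace.real_norm_sq_eq, div_self (pow_pos hpos 2).ne']

/-- The slot response matrix of slot `s` at shape `S` (the `Q` of `excQS`, in the §4 vocabulary). -/
def slotQ (W : LatticeShear.LatticeWord k) (M : ℝ) (S : Torus.Visc4 (Fin 3)) (s : Fin k) : Matrix (Fin 3) (Fin 3) ℝ :=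
  qsResp W.ramp (4 * Real.pi ^ 2 * ‖Torus.latticeVec (W.phase s).m‖ ^ 2 * M * (W.phase s).τ)
    (regBlock S (mhat (W.phase s))) * projPerp (mhat (W.phase s))

/-- The slot prefactor `τ_s / (2 (2π|m_s|)⁴ · period)` of `excQS`. -/
def slotCoef (W : LatticeShear.LatticeWord k) (s : Fin k) : ℝ :=
  (W.phase s).τ / (2 * (2 * Real.pi * ‖Torus.latticeVec (W.phase s).m‖) ^ 4) / W.period

/-- `excQS` entrywise in the §4 vocabulary (definitional). [folklore] -/
theorem excQS_apply (W : LatticeShear.LatticeWord k) (M : ℝ) (S : Torus.Visc4 (Fin 3)) (i a j b : Fin 3) :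
    excQS W M S i a j b = ∑ s, slotCoef W s * ((W.phase s).e a * (W.phase s).e b) * slotQ W M S s i j := rfl

/-- The transverse bilinear symbol is additive over a finite family of tensors. [folklore] -/
theorem bsymb_finsetSum {ι : Type*} (t : Finset ι) (F : ι → Torus.Visc4 (Fin 3)) (κ p q : Fin 3 → ℝ) :
    Torus.bsymb (∑ x ∈ t, F x) κ p q = ∑ x ∈ t, Torus.bsymb (F x) κ p q := by
  let φ : Torus.Visc4 (Fin 3) →+ ℝ :=
    { toFun := fun 𝔸 => Torus.bsymb 𝔸 κ p q
      map_zero' := Torus.bsymb_zero κ p q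
      map_add' := fun 𝔸 𝔹 => Torus.bsymb_add 𝔸 𝔹 κ p q }
  exact map_sum φ F t

/-- The transverse bilinear symbol of ONE slot tensor `c · e_a e_b · Q_{ij}`: `c (e·k)² · pᵀ Q q`. [folklore] -/
theorem bsymb_slot (c : ℝ) (e : Fin 3 → ℝ) (Q : Matrix (Fin 3) (Fin 3) ℝ) (κ p q : Fin 3 → ℝ) :
    Torus.bsymb (fun i a j b => c * (e a * e b) * Q i j) κ p q
      = c * (∑ a, e a * κ a) ^ 2 * ∑ i, ∑ j, p i * Q i j * q j := by
  unfold Torus.bsymb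
  have h1 : ∀ i a j b : Fin 3, c * (e a * e b) * Q i j * p i * κ a * q j * κ b
      = c * ((e a * κ a) * (e b * κ b) * (p i * Q i j * q j)) := by intros; ring
  simp only [h1, ← Finset.mul_sum]
  rw [mul_assoc]
  congr 1
  rw [sq, Finset.mul_sum]
  refine Finset.sum_congr rfl fun i _ => ?_
  rw [Finset.mul_sum, Finset.sum_comm]
  refine Finset.sum_congr rfl fun j _ => ?_
  rw [Finset.sum_mul_sum, Finset.sum_mul]
  refine Finset.sum_congr rfl fun a _ => ?_
  rw [Finset.sum_mul]

/-- **The transverse bilinear symbol of `excQS`, slot by slot**: `β(k; p, q) = Σ_s coef_s (e_s·k)² · pᵀ Q_s q`. [folklore] -/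
theorem bsymb_excQS (W : LatticeShear.LatticeWord k) (M : ℝ) (S : Torus.Visc4 (Fin 3)) (κ p q : Fin 3 → ℝ) :
    Torus.bsymb (excQS W M S) κ p q =
      ∑ s, slotCoef W s * (∑ a, (W.phase s).e a * κ a) ^ 2 * ∑ i, ∑ j, p i * slotQ W M S s i j * q j := by
  have hfun : excQS W M S =
      ∑ s, fun i a j b => slotCoef W s * ((W.phase s).e a * (W.phase s).e b) * slotQ W M S s i j := by
    funext i a j b
    simp only [excQS_apply, Finset.sum_apply]
  rw [hfun, bsymb_finsetSum]
  exact Finset.sum_congr rfl fun s _ => bsymb_slot _ _ _ κ p q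

/-- The transverse symbol of `excQS`, slot by slot. [folklore] -/
theorem symb_excQS (W : LatticeShear.LatticeWord k) (M : ℝ) (S : Torus.Visc4 (Fin 3)) (q p : Fin 3 → ℝ) :
    Torus.symb (excQS W M S) q p =
      ∑ s, slotCoef W s * (∑ a, (W.phase s).e a * q a) ^ 2 * ∑ i, ∑ j, p i * slotQ W M S s i j * p j :=
  bsymb_excQS W M S q p p

/-- The period of a word is positive. [folklore] -/
private theorem period_pos' (W : LatticeShear.LatticeWord k) : 0 < W.period :=
  Finset.sum_pos (fun i _ => (W.phase i).τ_pos) ⟨⟨0, W.pos⟩, Finset.mem_univ _⟩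

/-- The slot prefactor is non-negative. [folklore] -/
theorem slotCoef_nonneg (W : LatticeShear.LatticeWord k) (s : Fin k) : 0 ≤ slotCoef W s := by
  unfold slotCoef
  have h1 := (W.phase s).τ_pos
  have h2 := period_pos' W
  positivity

/-- The non-dimensional slot relaxation `T_s = 4π²|m_s|²Mτ_s` is non-negative for `M ≥ 0`. [folklore] -/
theorem slotT_nonneg {M : ℝ} (hM : 0 ≤ M) (W : LatticeShear.LatticeWord k) (s : Fin k) :
    0 ≤ 4 * Real.pi ^ 2 * ‖Torus.latticeVec (W.phase s).m‖ ^ 2 * M * (W.phase s).τ := by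
  have h1 := (W.phase s).τ_pos
  positivity

/-- **The realised gain form, slot by slot**, over `x ≠ 0`: `gainForm(x)/x = Σ_s coef_s (e_s·q)² · f_{T_s}(x) (|p|² − (p·m̂_s)²)`
(`ϑ(T_s x) = x f_{T_s}(x)`, `mul_qsRespScalar_eq_slotWeight`). [folklore] -/
theorem gainForm_div (W : LatticeShear.LatticeWord k) (M : ℝ) {x : ℝ} (hx : x ≠ 0) (q p : Fin 3 → ℝ) :
    gainForm W M x q p / x = ∑ s, slotCoef W s * (∑ a, (W.phase s).e a * q a) ^ 2 *
      (qsRespScalar W.ramp (4 * Real.pi ^ 2 * ‖Torus.latticeVec (W.phase s).m‖ ^ 2 * M * (W.phase s).τ) x *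
        (∑ i, p i ^ 2 - (∑ i, p i * mhat (W.phase s) i) ^ 2)) := by
  unfold gainForm
  rw [Finset.sum_div]
  refine Finset.sum_congr rfl fun s _ => ?_
  rw [← mul_qsRespScalar_eq_slotWeight]
  unfold slotGainC slotCoef
  have hP : W.period ≠ 0 := (period_pos' W).ne'
  field_simp

/-- **THE QUASI-STATIC PINCH, upper half**: `symb (excQS W M S) q p ≤ gainForm W M a q p / a` for every shape `S` with symmetric
transverse blocks (`OddSmall S 0`) in the window `NearIso S a b`, `0 < a`, `M ≥ 0`, and ALL `q, p` (not only transverse pairs). [folklore] -/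
theorem symb_excQS_le (W : LatticeShear.LatticeWord k) {M : ℝ} (hM : 0 ≤ M) {S : Torus.Visc4 (Fin 3)} {a b : ℝ}
    (ha : 0 < a) (hodd : Torus.OddSmall S 0) (hnear : Torus.NearIso S a b) (q p : Fin 3 → ℝ) :
    Torus.symb (excQS W M S) q p ≤ gainForm W M a q p / a := by
  rw [symb_excQS, gainForm_div W M ha.ne' q p]
  refine Finset.sum_le_sum fun s _ => ?_
  refine mul_le_mul_of_nonneg_left ?_ (mul_nonneg (slotCoef_nonneg W s) (sq_nonneg _))
  unfold slotQ
  exact sum_sum_mul_qsResp_regBlock_projPerp_le hodd hnear (sum_mhat_sq _) (slotT_nonneg hM W s) p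

/-- **THE QUASI-STATIC PINCH, lower half**: `gainForm W M b q p / b ≤ symb (excQS W M S) q p` (same hypotheses, `0 < b`). [folklore] -/
theorem le_symb_excQS (W : LatticeShear.LatticeWord k) {M : ℝ} (hM : 0 ≤ M) {S : Torus.Visc4 (Fin 3)} {a b : ℝ}
    (hb : 0 < b) (hodd : Torus.OddSmall S 0) (hnear : Torus.NearIso S a b) (q p : Fin 3 → ℝ) :
    gainForm W M b q p / b ≤ Torus.symb (excQS W M S) q p := by
  rw [symb_excQS, gainForm_div W M hb.ne' q p]
  refine Finset.sum_le_sum fun s _ => ?_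
  refine mul_le_mul_of_nonneg_left ?_ (mul_nonneg (slotCoef_nonneg W s) (sq_nonneg _))
  unfold slotQ
  exact le_sum_sum_mul_qsResp_regBlock_projPerp hodd hnear (sum_mhat_sq _) (slotT_nonneg hM W s) p

/-- **`excQS` preserves symmetric transverse blocks**: `OddSmall (excQS W M S) 0` whenever `OddSmall S 0` (every slot response
`f_{T_s}(B̂_s) P_s` is a symmetric bilinear form). [folklore] -/
theorem oddSmall_excQS (W : LatticeShear.LatticeWord k) (M : ℝ) {S : Torus.Visc4 (Fin 3)} (hodd : Torus.OddSmall S 0) :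
    Torus.OddSmall (excQS W M S) 0 := by
  intro κ p q _ _
  rw [bsymb_excQS, bsymb_excQS]
  have h : ∀ s, ∑ i, ∑ j, p i * slotQ W M S s i j * q j = ∑ i, ∑ j, q i * slotQ W M S s i j * p j := fun s => by
    unfold slotQ
    exact sum_sum_mul_qsResp_regBlock_projPerp_comm hodd (sum_mhat_sq _) _ _ p q
  simp only [h, sub_self, zero_pow two_ne_zero, zero_mul, le_refl]

/-- **`QSPinch W M` of `Cruxes/LagrangianRenormalisationStep/LoewnerWindowSketch.lean` (S2), VERBATIM body, PROVED**: for `M ≥ 0`, every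
shape `S` with symmetric transverse blocks in the window `[a, b]`, `0 < a ≤ b`: `excQS W M S` has symmetric transverse blocks and its transverse
symbol is pinched, `gainForm(b)/b ≤ symb (excQS S) ≤ gainForm(a)/a`, on unit transverse pairs (indeed on all pairs: `symb_excQS_le`,
`le_symb_excQS`).  The Loewner order-reversal of the quasi-static response: the (W) half of `stub_cellLawV0_IS` reduces to inequalities between
the explicit quartic forms `gainForm`. [folklore] -/
theorem qsPinch (W : LatticeShear.LatticeWord k) (M : ℝ) :
    0 ≤ M → ∀ S : Torus.Visc4 (Fin 3), ∀ a b : ℝ, 0 < a → a ≤ b → Torus.OddSmall S 0 → Torus.NearIso S a b →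
      Torus.OddSmall (excQS W M S) 0 ∧
      ∀ qp ∈ transversePairs,
        gainForm W M b qp.1 qp.2 / b ≤ Torus.symb (excQS W M S) qp.1 qp.2 ∧
        Torus.symb (excQS W M S) qp.1 qp.2 ≤ gainForm W M a qp.1 qp.2 / a := by
  intro hM S a b ha hab hodd hnear
  refine ⟨oddSmall_excQS W M hodd, fun qp _ => ⟨?_, ?_⟩⟩
  · exact le_symb_excQS W hM (ha.trans_le hab) hodd hnear qp.1 qp.2
  · exact symb_excQS_le W hM ha hodd hnear qp.1 qp.2

end Assembly

end Summit.AnomalousDissipation.AnomalousDissipation.Theorems.SolenoidalFractalHomogenisation.LagrangianStep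

end
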